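import Mathlib
import Summits.AtomisticToContinuum.FouriersLaw.Theorems.EmbeddedDrudeMourreMourreDissolutionFermiGoldenRuleThreshold
import Summits.AtomisticToContinuum.FouriersLaw.Theorems.EmbeddedDrudeMourreMourreDissolutionLevelShiftPushforward
import Summits.AtomisticToContinuum.FouriersLaw.Theorems.EmbeddedDrudeMourreMourreDissolutionPoissonLocallyUniform
import Summits.AtomisticToContinuum.FouriersLaw.Theorems.EmbeddedDrudeMourreMourreDissolutionDensityApproximation
import Summits.AtomisticToContinuum.FouriersLaw.Theorems.EmbeddedDrudeMourreMourreDissolutionPeriodisation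
import Summits.AtomisticToContinuum.FouriersLaw.Theorems.EmbeddedDrudeMourreMourreDissolutionMonotoneFibreDensity
import Summits.AtomisticToContinuum.FouriersLaw.Theorems.EmbeddedDrudeMourreMourreDissolutionRegularValueDensity
import Summits.AtomisticToContinuum.FouriersLaw.Theorems.EmbeddedDrudeMourreMourreDissolutionSlabNonconcentration
import Summits.AtomisticToContinuum.FouriersLaw.Theorems.EmbeddedDrudeMourreMourreDissolutionContinuousDensityAssembly
import HarnessLib

/-!
# `MourreDissolution`, line `swap-odd-threshold-rigidity`: THE FREE LEVEL SHIFT IS CONTINUOUS THROUGH THE THRESHOLD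
(crux `EmbeddedDrudeMourre.MourreDissolution`, item stmt-AtomisticToContinuum-12594; corollary file, `--supports`)

Unconditional corollaries of the landed stubs of the line (lead c9): stub B of the checked skeleton
(`Sig.stub_freeLevelShift`, "free second-order level shift at the threshold = Fermi's golden rule, locally
uniformly and continuously in the frequency") together with its pieces B1 (`Sig.stub_thresholdDensity`) and CONT
(`Sig.stub_thresholdDensityContinuous`) are THEOREMS of the tree:
* CONT = ASM (GLUE, PER, REG ∘ REG-loc, NC) — `stub_continuousDensityAssembly` fed with `stub_densityApproximation`,
  `stub_periodisation`, `stub_regularValueDensity stub_monotoneFibreDensity`, `stub_slabNonconcentration`;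
* B1: the continuous density `ρ` of CONT has Poisson integrals converging to `πρ(0)` at `E = 0` (B2,
  `stub_poissonLocallyUniform`), these ARE `R_f(ν,0)` (B0, `stub_levelShiftPushforward`), and
  `R_f(ν,0) → (4π/alsPrefactor)·q(f)` (`fermiGoldenRule_threshold`, with `q(f) < ∞` by
  `boltzmannForm_lt_top_of_contDiff_two`); uniqueness of limits along `𝓝[>] 0` gives the value clause;
* B: `ρ := π·ρ̃` and B2 again for the locally uniform convergence on the window.
(The same glue is kernel-checked inside the Cruxes skeleton as `stub_thresholdDensity_of`, `stub_freeLevelShift_of`;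
here it becomes importable.) [cite: AokiLukkarinenSpohn2006, eqs. (3.17)-(3.20), (4.1), (4.10)-(4.11), (4.16)]
-/

noncomputable section

namespace Summit.AtomisticToContinuum.FouriersLaw.Theorems.MourreDissolution

open MeasureTheory Filter Set Function Topology
open scoped ENNReal NNReal Topology
open Literature.MathematicalPhysics.KineticTheory
open Literature.MathematicalPhysics.KineticTheory.PhononBoltzmann

/-- **The bracket-weighted two-phonon density of states is continuous at the threshold** (CONT of line
`swap-odd-threshold-rigidity`, unconditional): for `ω₂ > 0`, couplings `a, b` and a `2π`-periodic `C³` profile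
`f`, the pushforward `Ω_*(W dk)` of the weight `W = Φ²(∏ω)⁻²[f]²` on the cell under the pair resonance function has a
continuous non-negative density on a window around `0`. [cite: AokiLukkarinenSpohn2006, eqs. (4.1), (4.10)-(4.11), (4.16)] -/
theorem thresholdDensityContinuous :
    ∀ ω₂ a b : ℝ, 0 < ω₂ → ∀ f : ℝ → ℝ, Function.Periodic f (2 * Real.pi) → ContDiff ℝ 3 f →
        ∃ δ : ℝ, 0 < δ ∧ ∃ ρ : ℝ → ℝ, ContinuousOn ρ (Set.Ioo (-δ) δ) ∧ (∀ x ∈ Set.Ioo (-δ) δ, 0 ≤ ρ x) ∧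
          ((MeasureTheory.Measure.map (fun p : ℝ × ℝ × ℝ => resonanceFn ω₂ p.1 p.2.2 p.2.1)
              (((volume.restrict (Set.Ioc (-Real.pi) Real.pi)).prod
                  ((volume.restrict (Set.Ioc (-Real.pi) Real.pi)).prod
                    (volume.restrict (Set.Ioc (-Real.pi) Real.pi)))).withDensity
                (fun p : ℝ × ℝ × ℝ => ENNReal.ofReal
                  (vertex a b p.1 p.2.2 p.2.1 ^ 2 /
                      (dispersion ω₂ p.1 * dispersion ω₂ p.2.2 * dispersion ω₂ p.2.1 *
                        dispersion ω₂ (p.1 + p.2.2 - p.2.1)) ^ 2 *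
                    (f p.1 + f p.2.2 - f p.2.1 - f (p.1 + p.2.2 - p.2.1)) ^ 2))))).restrict (Set.Ioo (-δ) δ) =
            (volume.restrict (Set.Ioo (-δ) δ)).withDensity (fun x => ENNReal.ofReal (ρ x)) :=
  stub_continuousDensityAssembly stub_densityApproximation stub_periodisation
    (stub_regularValueDensity stub_monotoneFibreDensity) stub_slabNonconcentration

/-- **The threshold density and its value** (B1 of line `swap-odd-threshold-rigidity`, unconditional): the
continuous density `ρ̃` of `Ω_*(W dk)` near `0` has `π ρ̃(0) = (4π/alsPrefactor)·q_{ω₂,a,b}(f)` — Fermi's golden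
rule at the threshold equals ALS's resolved collision form. [cite: AokiLukkarinenSpohn2006, eqs. (3.17)-(3.20), (4.10)-(4.11)] -/
theorem thresholdDensity :
    ∀ ω₂ a b : ℝ, 0 < ω₂ → ∀ f : ℝ → ℝ, Function.Periodic f (2 * Real.pi) → ContDiff ℝ 3 f →
      ∃ δ : ℝ, 0 < δ ∧ ∃ ρ : ℝ → ℝ, ContinuousOn ρ (Set.Ioo (-δ) δ) ∧ (∀ x ∈ Set.Ioo (-δ) δ, 0 ≤ ρ x) ∧
        ENNReal.ofReal (Real.pi * ρ 0) = ENNReal.ofReal (4 * Real.pi / alsPrefactor) * boltzmannForm ω₂ a b f ∧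
        ((MeasureTheory.Measure.map (fun p : ℝ × ℝ × ℝ => resonanceFn ω₂ p.1 p.2.2 p.2.1)
            (((volume.restrict (Set.Ioc (-Real.pi) Real.pi)).prod
                ((volume.restrict (Set.Ioc (-Real.pi) Real.pi)).prod
                  (volume.restrict (Set.Ioc (-Real.pi) Real.pi)))).withDensity
              (fun p : ℝ × ℝ × ℝ => ENNReal.ofReal
                (vertex a b p.1 p.2.2 p.2.1 ^ 2 /
                    (dispersion ω₂ p.1 * dispersion ω₂ p.2.2 * dispersion ω₂ p.2.1 *
                      dispersion ω₂ (p.1 + p.2.2 - p.2.1)) ^ 2 *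
                  (f p.1 + f p.2.2 - f p.2.1 - f (p.1 + p.2.2 - p.2.1)) ^ 2))))).restrict (Set.Ioo (-δ) δ) =
          (volume.restrict (Set.Ioo (-δ) δ)).withDensity (fun x => ENNReal.ofReal (ρ x)) := by
  intro ω₂ a b hω f hper hf
  obtain ⟨δ, hδ, ρ, hρc, hρ0, hwin⟩ := thresholdDensityContinuous ω₂ a b hω f hper hf
  have hf2 : ContDiff ℝ 2 f := hf.of_le (by norm_num)
  have hq : boltzmannForm ω₂ a b f < ⊤ := boltzmannForm_lt_top_of_contDiff_two ω₂ a b hω f hper hf2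
  -- FGR: `R_f(ν, 0) → (4π/als)·q(f)`
  have h1 := fermiGoldenRule_threshold ω₂ a b hω f hper hf2
  -- B0: `R_f(ν, E)` is the Poisson integral of the finite pushforward measure `m_f`
  obtain ⟨hmfin, hR⟩ := stub_levelShiftPushforward ω₂ a b hω f hf.continuous
  -- B2: the Poisson integrals of `m_f` converge to `πρ` locally uniformly on the window; at `E = 0`:
  have h0mem : (0 : ℝ) ∈ Set.Ioo (-δ) δ := ⟨by linarith, hδ⟩
  have h2 := (stub_poissonLocallyUniform _ hmfin δ hδ ρ hρc hρ0 hwin).tendsto_at h0mem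
  have h3 : Tendsto _ (𝓝[>] (0 : ℝ)) (𝓝 (Real.pi * ρ 0)) :=
    h2.congr' (eventually_nhdsWithin_of_forall fun ν hν => (hR ν hν 0).symm)
  simp only [sub_zero] at h3
  -- uniqueness of limits along `𝓝[>] 0`
  have heq : Real.pi * ρ 0 = 4 * Real.pi / alsPrefactor * (boltzmannForm ω₂ a b f).toReal :=
    tendsto_nhds_unique h3 h1
  refine ⟨δ, hδ, ρ, hρc, hρ0, ?_, hwin⟩
  rw [heq, ENNReal.ofReal_mul (div_nonneg (by positivity) alsPrefactor_pos.le),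
    ENNReal.ofReal_toReal hq.ne]

/-- **The free level shift is continuous through the threshold, with the Fermi-golden-rule value** (stub B of
line `swap-odd-threshold-rigidity`, unconditional): for `ω₂ > 0`, couplings `a, b` and a `2π`-periodic `C³`
profile `f`, the Poisson-regularised bracket-weighted pair spectral function
`R_f(ν, E) = ∫∫∫ Φ²(∏ω)⁻²[f]²·ν/((Ω − E)² + ν²)` converges, as `ν ↓ 0`, locally uniformly in `E` on a window
`(−δ, δ)`, to a continuous `ρ` with `ρ(0) = (4π/alsPrefactor)·q_{ω₂,a,b}(f)`.
[cite: AokiLukkarinenSpohn2006, eqs. (3.17)-(3.20), (4.1), (4.10)-(4.11), (4.16)] -/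
theorem freeLevelShift_threshold :
    ∀ ω₂ a b : ℝ, 0 < ω₂ → ∀ f : ℝ → ℝ, Function.Periodic f (2 * Real.pi) → ContDiff ℝ 3 f →
      ∃ δ : ℝ, 0 < δ ∧ ∃ ρ : ℝ → ℝ, ContinuousOn ρ (Set.Ioo (-δ) δ) ∧
        ENNReal.ofReal (ρ 0) = ENNReal.ofReal (4 * Real.pi / alsPrefactor) * boltzmannForm ω₂ a b f ∧
        TendstoLocallyUniformlyOn
          (fun (ν : ℝ) (E : ℝ) => ∫ k₁ in Set.Ioc (-Real.pi) Real.pi, ∫ k₃ in Set.Ioc (-Real.pi) Real.pi,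
            ∫ k₂ in Set.Ioc (-Real.pi) Real.pi,
              vertex a b k₁ k₂ k₃ ^ 2 /
                  (dispersion ω₂ k₁ * dispersion ω₂ k₂ * dispersion ω₂ k₃ * dispersion ω₂ (k₁ + k₂ - k₃)) ^ 2 *
                (f k₁ + f k₂ - f k₃ - f (k₁ + k₂ - k₃)) ^ 2 *
                (ν / ((resonanceFn ω₂ k₁ k₂ k₃ - E) ^ 2 + ν ^ 2)))
          ρ (𝓝[>] (0 : ℝ)) (Set.Ioo (-δ) δ) := by
  intro ω₂ a b hω f hper hf
  obtain ⟨δ, hδ, ρ, hρc, hρ0, hval, hwin⟩ := thresholdDensity ω₂ a b hω f hper hf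
  obtain ⟨hfin, hR⟩ := stub_levelShiftPushforward ω₂ a b hω f hf.continuous
  refine ⟨δ, hδ, fun E => Real.pi * ρ E, continuousOn_const.mul hρc, hval, ?_⟩
  have hconv := stub_poissonLocallyUniform _ hfin δ hδ ρ hρc hρ0 hwin
  refine (tendstoLocallyUniformlyOn_iff_forall_isCompact isOpen_Ioo).2 (fun K hK hKc => ?_)
  have h1 := (tendstoLocallyUniformlyOn_iff_forall_isCompact isOpen_Ioo).1 hconv K hK hKc
  refine h1.congr ?_
  filter_upwards [self_mem_nhdsWithin] with ν hν
  intro E _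
  exact (hR ν hν E).symm

end Summit.AtomisticToContinuum.FouriersLaw.Theorems.MourreDissolution
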